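/-
Copyright (c) 2026 the pub-hodgecm-mathlib formalisation cell (harness21).  Prover seat hodgecm-mathlib-K2Liu-p12 (g0): Track B «K2-LIT»,
#184♮ = hLiu418 = stmt-HodgeConjecture-24832; Road Φ of socket #41, organ Φ5 «bad finite places» (LEAD F0P6-plan (g13) rulings «M-157c∕h»), file F4b-2.
-/
import Summits.HodgeConjecture.HodgeConjecture.Theorems.K2LiuShellStabilization      -- ★ F2: shells ⇒ ball, entire, bound
import HarnessLib

/-!
# Crux `HLiu418`, Road Φ of socket #41, organ Φ5 — FILE F4b-2: THE THREE HEADS OF THE BAD-PLACE WHITTAKER COEFFICIENT (ball formula, entire, bound)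

Cell `hodgecm-mathlib`, crux item hLiu418 = `stmt-HodgeConjecture-24832`, route of record `HCCMUnconditional`; squad K2 ∕ K2Liu, road `K2_Liu`,
socket #41 `sig_K2LiuSiegelEisensteinContinuation`, Road Φ, organ Φ5 (spec `K2/K2Liu-p12/g0/SPEC-PHI5-F3-LeviSupplyAndCovering.K2Liu-p12-g0.md` §F4b).
THEOREMS ONLY (no `def`, no `instance`, no `notation`, no named-fact hypothesis, no `sorry`); lane `--supports stmt-HodgeConjecture-24832`
(count-neutral helper; closes no socket by itself).  Carrier-free (any measure space `V` with a `ℤ`-indexed family of «balls»), so that the Φ9 tie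
instantiates it VERBATIM with `V = S = Skew`, `B a = {t | ∀ i j w, Valued.v (t.1 i j w) ≤ Valued.v (toPlace v w π)^a}`, `φ s t = f s (w_Δ n(t))`,
`χ t = ψ_v(−τ(tr(β t)))` and the far-shell vanishing of ★ F4b-1 `K2LiuBadPlaceWhittakerFarShells.setIntegral_farShell_eq_zero` (`k ≥ K = K₁ + 4b + 2b′`).

THE HEADS (Karel's lemma, second half; [Casselman1980, §3], [KudlaRallis1994, §2], [Shimura1997, §18]).  Let `B : ℤ → Set V` be ANTITONE in the exponent
(`a ≤ a′ ⇒ B a′ ⊆ B a`), measurable of finite measure, `φ : ℂ → V → ℂ`, `χ : V → ℂ` with `‖χ‖ ≤ 1`, measurable, `φ s` bounded on each ball, and suppose the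
SHELL INTEGRALS VANISH BEYOND `K`: `∫_{B(−k) ∖ B(−k+1)} φ s · χ = 0` for all `k ≥ K`, all `s`.
* `setIntegral_ball_eq_of_farShell` — BALL FORMULA: `∫_{B(−k)} φ s·χ = ∫_{B(−(K−1))} φ s·χ` for every `k ≥ K − 1` and EVERY `s` (★ F2
  `setIntegral_eq_setIntegral_of_shells_int`): the local Whittaker coefficient `W_{β,v}(f_s) := ∫_{B(−(K−1))} φ s·χ` is a definition-free object, equal to
  every larger truncation;
* `integral_eq_setIntegral_ball_of_farShell` — where `φ s · χ ∈ L¹(V)` and the balls exhaust `V`, `∫_V φ s·χ = W_{β,v}(f_s)` (★ F2 `integral_eq_setIntegral_of_shells`);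
* `differentiable_setIntegral_ball` — ENTIRE: for a family entire in `s` at each point and locally (in `s`) uniformly bounded on the ball (the `K_v`-flat Siegel
  families), `s ↦ W_{β,v}(f_s)` is `Differentiable ℂ` (★ F2 `differentiable_setIntegral_of_locally_bounded`);
* `norm_setIntegral_ball_le` — BOUND: `‖W_{β,v}(f_s)‖ ≤ C(f,s)·μ(B(−(K−1)))` (★ F2); with `K = K₁ + 4b + 2b′` (★ F4b-1) and `μ(B(−a)) = q_v^{O(a)}` this is the
  announced `C_v(f,s)·|det β|_v^{−A}(1+‖β‖_v)^A` — polynomial in `β`, NOT uniform in `β` (census «≠» to the Φ9 sheet, adopted as M-156n (A-1)).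
(The lattice-support head is ★ F4a `K2LiuBadPlaceWhittakerShells.setIntegral_eq_zero_of_unipotent_translate`.)

## References
* [Casselman1980] W. Casselman, *The unramified principal series of p-adic groups I*, Compositio Math. 40 (1980), §3.
* [KudlaRallis1994] S. Kudla, S. Rallis, Ann. of Math. 140 (1994), §2.   * [Shimura1997] G. Shimura, CBMS 93 (1997), §18.
-/

set_option autoImplicit false
-- the mandated namespace repeats the single-problem summit's segment (`HodgeConjecture.HodgeConjecture`)
set_option linter.dupNamespace false

noncomputable section

open scoped ENNReal
open MeasureTheory Set Filter Metric
open Summit.HodgeConjecture.HodgeConjecture.Cruxes.HLiu418.K2LiuShellStabilization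

namespace Summit.HodgeConjecture.HodgeConjecture.Cruxes.HLiu418.K2LiuBadPlaceWhittakerHeads

variable {V : Type*} [MeasurableSpace V] (μ : Measure V)

/-- integrability of a bounded measurable integrand `φ·χ` on a set of finite measure. [cite: Casselman1980, §3] -/
theorem integrableOn_mul_of_bound {A : Set V} (hA : MeasurableSet A) (hAμ : μ A ≠ ∞) {φ χ : V → ℂ} (hφm : Measurable φ) (hχm : Measurable χ)
    (hχ1 : ∀ x, ‖χ x‖ ≤ 1) {C : ℝ} (hC : ∀ x ∈ A, ‖φ x‖ ≤ C) : IntegrableOn (fun x => φ x * χ x) A μ := by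
  haveI : IsFiniteMeasure (μ.restrict A) := isFiniteMeasure_restrict.2 hAμ
  refine Integrable.of_bound ((hφm.mul hχm).aestronglyMeasurable) C ?_
  filter_upwards [ae_restrict_mem hA] with x hx
  rw [norm_mul]
  have hC0 : 0 ≤ C := (norm_nonneg _).trans (hC x hx)
  calc ‖φ x‖ * ‖χ x‖ ≤ C * 1 := mul_le_mul (hC x hx) (hχ1 x) (norm_nonneg _) hC0
    _ = C := mul_one C

/-- **BALL FORMULA.**  If the shell integrals `∫_{B(−k) ∖ B(−k+1)} φ s·χ` vanish for `k ≥ K` (★ F4b-1 at a bad finite place), then for every `s` and every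
`k ≥ K − 1`: `∫_{B(−k)} φ s·χ dμ = ∫_{B(−(K−1))} φ s·χ dμ` — the local Whittaker coefficient is ONE compact-ball integral, independent of the truncation.
[cite: Casselman1980, §3] [cite: KudlaRallis1994, §2] -/
theorem setIntegral_ball_eq_of_farShell {B : ℤ → Set V} (hBm : ∀ a, MeasurableSet (B a)) (hanti : ∀ a a', a ≤ a' → B a' ⊆ B a)
    (hBfin : ∀ a, μ (B a) ≠ ∞) {φ : ℂ → V → ℂ} {χ : V → ℂ} (hφm : ∀ s, Measurable (φ s)) (hχm : Measurable χ) (hχ1 : ∀ x, ‖χ x‖ ≤ 1)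
    (hφC : ∀ s (a : ℤ), ∃ C : ℝ, ∀ x ∈ B a, ‖φ s x‖ ≤ C) {K : ℤ}
    (hshell : ∀ s (k : ℤ), K ≤ k → ∫ x in B (-k) \ B (-k + 1), φ s x * χ x ∂μ = 0)
    (s : ℂ) {k : ℤ} (hk : K - 1 ≤ k) : ∫ x in B (-k), φ s x * χ x ∂μ = ∫ x in B (-(K - 1)), φ s x * χ x ∂μ := by
  have h := setIntegral_eq_setIntegral_of_shells_int μ (B := fun k : ℤ => B (-k)) (fun k => hBm _) (fun a a' h => hanti _ _ (by omega))
    (g := fun x => φ s x * χ x) (fun k => by obtain ⟨C, hC⟩ := hφC s (-k); exact integrableOn_mul_of_bound μ (hBm _) (hBfin _) (hφm s) hχm hχ1 hC)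
    (k₀ := K - 1) (fun k hk' => by
      have := hshell s (k + 1) (by omega)
      rwa [show -(k + 1) + 1 = -k by ring] at this) hk
  simpa using h

/-- **THE WHOLE INTEGRAL IS THE BALL INTEGRAL** where it converges absolutely: if moreover `φ s·χ ∈ L¹(V, μ)` and the balls exhaust `V`, then
`∫_V φ s·χ dμ = ∫_{B(−(K−1))} φ s·χ dμ` (so the classical Whittaker integral, absolutely convergent for large `Re s`, IS the ball integral there, and the
ball integral is its continuation elsewhere). [cite: Casselman1980, §3] [cite: Shimura1997, §18] -/
theorem integral_eq_setIntegral_ball_of_farShell {B : ℤ → Set V} (hBm : ∀ a, MeasurableSet (B a)) (hanti : ∀ a a', a ≤ a' → B a' ⊆ B a)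
    (hcover : ∀ x : V, ∃ a : ℤ, x ∈ B a) {φ : ℂ → V → ℂ} {χ : V → ℂ} {K : ℤ}
    (hshell : ∀ s (k : ℤ), K ≤ k → ∫ x in B (-k) \ B (-k + 1), φ s x * χ x ∂μ = 0)
    (s : ℂ) (hint : Integrable (fun x => φ s x * χ x) μ) : ∫ x, φ s x * χ x ∂μ = ∫ x in B (-(K - 1)), φ s x * χ x ∂μ := by
  -- exhaust by the `ℕ`-indexed balls `B (−(K − 1) − j)`
  have h := integral_eq_setIntegral_of_shells μ (B := fun j : ℕ => B (-(K - 1) - j)) (fun j => hBm _)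
    (fun a a' h => hanti _ _ (by omega)) ?_ hint (k₀ := 0) (fun j _ => ?_)
  · simpa using h
  · refine eq_univ_of_forall fun x => mem_iUnion.2 ?_
    obtain ⟨a, ha⟩ := hcover x
    refine ⟨(-(K - 1) - a).toNat, hanti _ _ ?_ ha⟩
    have := Int.self_le_toNat (-(K - 1) - a)
    omega
  · have := hshell s (K - 1 + (j + 1)) (by omega)
    rw [show -(K - 1 + ((j : ℤ) + 1)) = -(K - 1) - ((j + 1 : ℕ) : ℤ) by push_cast; ring] at this
    rwa [show -(K - 1) - ((j + 1 : ℕ) : ℤ) + 1 = -(K - 1) - (j : ℕ) by push_cast; ring] at this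

/-- **ENTIRE in the parameter.**  For a family with `s ↦ φ s x` entire for every `x`, `φ s` measurable, and `φ` locally (in `s`) uniformly bounded on the ball
`B a` (the `K_v`-flat Siegel families: `f_s(g) = χ_v(…)|…|^{s+n/2} f₀(k(g))`), and a measurable unitary weight `χ`, the ball integral
`s ↦ ∫_{B a} φ s·χ dμ` is `Differentiable ℂ` — with the ball formula, `s ↦ W_{β,v}(f_s)` is entire. [cite: KudlaRallis1994, §2] [cite: Shimura1997, §18] -/
theorem differentiable_setIntegral_ball {A : Set V} (hA : MeasurableSet A) (hAμ : μ A ≠ ∞) {φ : ℂ → V → ℂ} {χ : V → ℂ}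
    (hdiff : ∀ x, Differentiable ℂ fun s => φ s x) (hφm : ∀ s, Measurable (φ s)) (hχm : Measurable χ) (hχ1 : ∀ x, ‖χ x‖ ≤ 1)
    (hbd : ∀ s₀ : ℂ, ∃ ε > 0, ∃ C : ℝ, ∀ s ∈ ball s₀ ε, ∀ x ∈ A, ‖φ s x‖ ≤ C) :
    Differentiable ℂ fun s => ∫ x in A, φ s x * χ x ∂μ := by
  refine differentiable_setIntegral_of_locally_bounded μ hA hAμ (K := fun s x => φ s x * χ x) (fun x => (hdiff x).mul_const (χ x))
    (fun s => ((hφm s).mul hχm).aestronglyMeasurable) fun s₀ => ?_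
  obtain ⟨ε, hε, C, hC⟩ := hbd s₀
  refine ⟨ε, hε, C, fun s hs x hx => ?_⟩
  rw [norm_mul]
  have hC0 : 0 ≤ C := (norm_nonneg _).trans (hC s hs x hx)
  calc ‖φ s x‖ * ‖χ x‖ ≤ C * 1 := mul_le_mul (hC s hs x hx) (hχ1 x) (norm_nonneg _) hC0
    _ = C := mul_one C

/-- **THE BOUND** `‖∫_{B a} φ s·χ‖ ≤ C·μ(B a)` for `‖φ s‖ ≤ C` on `B a` and `‖χ‖ ≤ 1`; with `a = −(K − 1)`, `K = K₁ + 4·ord_v(β) + 2·ord_v(β⁻¹)` (★ F4b-1) and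
`μ(B(−a)) = μ(B 0)·q_v^{O(a)}` this is polynomial in `|det β|_v^{−1}` and `‖β‖_v` — not uniform in `β`. [cite: Shimura1997, §18] -/
theorem norm_setIntegral_ball_le {A : Set V} (hAμ : μ A ≠ ∞) {φ χ : V → ℂ} {C : ℝ} (hφ : ∀ x ∈ A, ‖φ x‖ ≤ C) (hχ : ∀ x ∈ A, ‖χ x‖ ≤ 1) :
    ‖∫ x in A, φ x * χ x ∂μ‖ ≤ C * μ.real A :=
  norm_setIntegral_le_of_norm_le_mul_unit μ hAμ hφ hχ

end Summit.HodgeConjecture.HodgeConjecture.Cruxes.HLiu418.K2LiuBadPlaceWhittakerHeads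

end
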